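import Mathlib
import HarnessLib
import Literature.Analysis.FluidPDE.Tao2016AveragedNS.ViscousSmoothingBootstrap
import Summits.NavierStokesRegularity.NavierStokesRegularity.Theorems.WakeRatchetMinimalViscousBlowupLargeNuRegular

/-!
# Route `WakeRatchet`, crux `MinimalViscousBlowup` (stmt-NavierStokesRegularity-22743) — LINE g11-1 «threshold ray» (ns-idea-1 g11), input (E3) of
# STUB-PLAN-regularOpen.md for stub S2 `stub_regularOpen`: the SMALL-DATA RESTART ENVELOPE from an intermediate time

The dissipation bootstrap of `…LargeNuRegular` (S1) with a GENERAL datum: structure constants bounded by `M_α`, `λ = 1+ε₀ > 1`, `A > 0`,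
`ν ≥ 32 m² M_α λ² A`.
* `envelope_improve_of_datum` — one bootstrap step: datum `|X_{i,k}(0)| ≤ (A/2)λ^{−k}` on ALL shells and the doubled envelope `2Aλ^{−k}` on
  `[0,t]` improve to the envelope `Aλ^{−k}` (Duhamel bound `abs_le_of_dissipative_forcing`);
* `envelope_of_small_datum` — continuous induction: every regular solution on `[0,s]` with such a datum obeys `|X_{i,k}(t)| ≤ Aλ^{−k}` on `[0,s]`;
* `envelope_from_time` — **(E3)** the same from an intermediate time `t₁ ≥ 0` of a window `[0,s]` (time shift): if `|X_{i,k}(t₁)| ≤ (A/2)λ^{−k}`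
  then `|X_{i,k}(t)| ≤ Aλ^{−k}` on `[t₁,s]`;
* `tailEnergy_le_of_envelope` — an envelope `Aλ^{−k}` at a time bounds the tail energies `Σ_{n≤k≤N} Σ_i ½X_{i,k}² ≤ (m/2)A²(1−λ^{−2})^{−1}λ^{−2n}`
  (subcritical, `η = 1`, the shape `exists_viscousGlobal_of_subcriticalEnvelope_of_inTableClass` wants).
MODEL lattice ODEs only; nothing here concerns the Navier–Stokes equations.  `--supports stmt-NavierStokesRegularity-22743 --as helper`.
[cite: BarbatoMorandinRomito2011, §3.1 Prop. 3.3; Tao2016AveragedNS, §4 Lemma 4.1 (4.5)]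
-/

noncomputable section

-- the summit and its single sub-problem share the name (CONVENTIONS §1)
set_option linter.dupNamespace false

open Set Filter Topology

namespace Summit.NavierStokesRegularity.NavierStokesRegularity.Theorems.MinimalViscousBlowup.ThresholdRay

open Literature.Analysis.FluidPDE Literature.Analysis.FluidPDE.TaoCascade

variable {m : ℕ}

/-! ### §1 One bootstrap step from a general datum -/

/-- **One step of the dissipation bootstrap, general datum.**  Structure constants bounded by `M_α`, `λ = 1+ε₀ > 1`, `A > 0`,
`ν ≥ 32 m² M_α λ² A`.  If a solution of the `ν`-viscous lattice on `[0,t]` (no shells below `0` there) has datum `|X_{i,k}(0)| ≤ (A/2)λ^{−k}` and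
obeys the doubled envelope `|X_{i,k}(τ)| ≤ 2Aλ^{−k}` on `[0,t]`, then it obeys `|X_{i,k}(τ)| ≤ Aλ^{−k}` there.
[cite: BarbatoMorandinRomito2011, §3.1 Prop. 3.3] -/
theorem envelope_improve_of_datum {ε₀ ν Mα A : ℝ} (hε : 0 < ε₀) (hMα : 0 ≤ Mα) (hA : 0 < A)
    {α : Fin m → Fin m → Fin m → ℤ × ℤ × ℤ → ℝ} (hα : ∀ i₁ i₂ i₃ μ, |α i₁ i₂ i₃ μ| ≤ Mα)
    (hν0 : 0 < ν) (hν : 32 * (m : ℝ) ^ 2 * Mα * (1 + ε₀) ^ (2 : ℝ) * A ≤ ν)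
    {X : Fin m → ℤ → ℝ → ℝ} {t : ℝ}
    (h0 : ∀ i k, |X i k 0| ≤ A / 2 * (1 + ε₀) ^ (-(k : ℝ)))
    (hlow : ∀ i k, k < 0 → ∀ τ ∈ Icc 0 t, X i k τ = 0)
    (hder : ∀ i k, ∀ τ ∈ Icc 0 t, HasDerivWithinAt (X i k)
        (quadTerm ε₀ α X i k τ - ν * (1 + ε₀) ^ ((2 : ℝ) * k) * X i k τ) (Icc 0 t) τ)
    (hyp : ∀ τ ∈ Icc 0 t, ∀ i k, |X i k τ| ≤ 2 * A * (1 + ε₀) ^ (-(k : ℝ))) :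
    ∀ τ ∈ Icc 0 t, ∀ i k, |X i k τ| ≤ A * (1 + ε₀) ^ (-(k : ℝ)) := by
  -- adapted from `envelope_improve` (Theorems/WakeRatchetMinimalViscousBlowupLargeNuRegular.lean), datum step generalised
  intro τ hτ i k
  have hl1 : (1 : ℝ) ≤ 1 + ε₀ := by linarith
  have hl0 : (0 : ℝ) < 1 + ε₀ := by linarith
  have hpow : ∀ a : ℝ, 0 < (1 + ε₀) ^ a := fun a => Real.rpow_pos_of_pos hl0 a
  rcases lt_or_ge k 0 with hk | hk
  · rw [hlow i k hk τ hτ, abs_zero]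
    exact mul_nonneg hA.le (hpow _).le
  · have hk' : (0 : ℝ) ≤ (k : ℝ) := by exact_mod_cast hk
    set b : ℝ := 2 * A * (1 + ε₀) ^ (1 - (k : ℝ)) with hb
    have hb0 : 0 ≤ b := by rw [hb]; exact mul_nonneg (by linarith) (hpow _).le
    have hbnd : ∀ σ ∈ Icc 0 t, ∀ (j : Fin m) (k' : ℤ), k - 1 ≤ k' → |X j k' σ| ≤ b := by
      intro σ hσ j k' hk'
      refine (hyp σ hσ j k').trans ?_
      rw [hb]
      refine mul_le_mul_of_nonneg_left (Real.rpow_le_rpow_of_exponent_le hl1 ?_) (by linarith)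
      have : ((k : ℝ)) - 1 ≤ (k' : ℝ) := by exact_mod_cast (by linarith : k - 1 ≤ k')
      linarith
    set Q : ℝ := 16 * (m : ℝ) ^ 2 * Mα * A ^ 2 * (1 + ε₀) ^ ((k : ℝ) / 2 + 2) with hQ
    have hq : ∀ σ ∈ Icc 0 t, |quadTerm ε₀ α X i k σ| ≤ Q := by
      intro σ hσ
      have h := abs_quadTerm_le_of_bounds hl0.le hMα hα X i k σ hb0 hb0
        (fun j => hbnd σ hσ j (k - 1) le_rfl) (fun j => hbnd σ hσ j k (by linarith))
        (fun j => hbnd σ hσ j (k + 1) (by linarith))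
      refine h.trans ?_
      have h1 : (1 + ε₀) ^ ((5 : ℝ) * ((k : ℝ) - 1) / 2) ≤ (1 + ε₀) ^ ((5 : ℝ) * k / 2) :=
        Real.rpow_le_rpow_of_exponent_le hl1 (by linarith)
      have hmain : (1 + ε₀) ^ ((5 : ℝ) * k / 2) * (b * b) = 4 * A ^ 2 * (1 + ε₀) ^ ((k : ℝ) / 2 + 2) := by
        rw [hb, show (k : ℝ) / 2 + 2 = (5 : ℝ) * k / 2 + ((1 - (k : ℝ)) + (1 - (k : ℝ))) by ring,
          Real.rpow_add hl0, Real.rpow_add hl0]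
        ring
      have hmm : 0 ≤ (m : ℝ) ^ 2 * Mα := by positivity
      calc (m : ℝ) ^ 2 * Mα * ((1 + ε₀) ^ ((5 : ℝ) * k / 2) * (b * b + 2 * (b * b)) +
              (1 + ε₀) ^ ((5 : ℝ) * ((k : ℝ) - 1) / 2) * (b * b))
          ≤ (m : ℝ) ^ 2 * Mα * ((1 + ε₀) ^ ((5 : ℝ) * k / 2) * (b * b + 2 * (b * b)) +
              (1 + ε₀) ^ ((5 : ℝ) * k / 2) * (b * b)) := by
            refine mul_le_mul_of_nonneg_left (add_le_add le_rfl ?_) hmm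
            exact mul_le_mul_of_nonneg_right h1 (mul_nonneg hb0 hb0)
        _ = 4 * ((m : ℝ) ^ 2 * Mα) * ((1 + ε₀) ^ ((5 : ℝ) * k / 2) * (b * b)) := by ring
        _ = Q := by rw [hmain, hQ]; ring
    have hκ : 0 < ν * (1 + ε₀) ^ ((2 : ℝ) * k) := mul_pos hν0 (hpow _)
    have hdiss := abs_le_of_dissipative_forcing hκ (hder i k) hq τ hτ
    have hQκ : Q / (ν * (1 + ε₀) ^ ((2 : ℝ) * k)) ≤ A / 2 * (1 + ε₀) ^ (-(k : ℝ)) := by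
      rw [div_le_iff₀ hκ]
      have e1 : (1 + ε₀) ^ ((k : ℝ) / 2 + 2) ≤
          (1 + ε₀) ^ (2 : ℝ) * ((1 + ε₀) ^ (-(k : ℝ)) * (1 + ε₀) ^ ((2 : ℝ) * k)) := by
        rw [← Real.rpow_add hl0, ← Real.rpow_add hl0]
        exact Real.rpow_le_rpow_of_exponent_le hl1 (by linarith)
      calc Q = 16 * (m : ℝ) ^ 2 * Mα * A ^ 2 * (1 + ε₀) ^ ((k : ℝ) / 2 + 2) := hQ
        _ ≤ 16 * (m : ℝ) ^ 2 * Mα * A ^ 2 *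
              ((1 + ε₀) ^ (2 : ℝ) * ((1 + ε₀) ^ (-(k : ℝ)) * (1 + ε₀) ^ ((2 : ℝ) * k))) :=
            mul_le_mul_of_nonneg_left e1 (by positivity)
        _ = (32 * (m : ℝ) ^ 2 * Mα * (1 + ε₀) ^ (2 : ℝ) * A) *
              (A * ((1 + ε₀) ^ (-(k : ℝ)) * (1 + ε₀) ^ ((2 : ℝ) * k))) / 2 := by ring
        _ ≤ ν * (A * ((1 + ε₀) ^ (-(k : ℝ)) * (1 + ε₀) ^ ((2 : ℝ) * k))) / 2 := by
            have e2 : 0 ≤ A * ((1 + ε₀) ^ (-(k : ℝ)) * (1 + ε₀) ^ ((2 : ℝ) * k)) :=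
              mul_nonneg hA.le (mul_nonneg (hpow _).le (hpow _).le)
            gcongr
        _ = A / 2 * (1 + ε₀) ^ (-(k : ℝ)) * (ν * (1 + ε₀) ^ ((2 : ℝ) * k)) := by ring
    calc |X i k τ| ≤ |X i k 0| + Q / (ν * (1 + ε₀) ^ ((2 : ℝ) * k)) := hdiss
      _ ≤ A / 2 * (1 + ε₀) ^ (-(k : ℝ)) + A / 2 * (1 + ε₀) ^ (-(k : ℝ)) := add_le_add (h0 i k) hQκ
      _ = A * (1 + ε₀) ^ (-(k : ℝ)) := by ring

/-! ### §2 The envelope from a small datum, by continuous induction on the low shells -/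

/-- **The small-datum envelope.**  Structure constants bounded by `M_α`, `λ = 1+ε₀ > 1`, `A > 0`, `ν ≥ 32 m² M_α λ² A`.  Every regular solution of
the `ν`-viscous lattice on a window `[0,s]` (continuous components, no shells below `0`, (4.5)-weighted bound finite, the viscous motion within
`[0,s]`) whose datum obeys `|X_{i,k}(0)| ≤ (A/2)λ^{−k}` on all shells obeys `|X_{i,k}(t)| ≤ Aλ^{−k}` on `[0,s]`.
[cite: BarbatoMorandinRomito2011, §3.1 Prop. 3.3; Tao2016AveragedNS, §4 Lemma 4.1 (4.5)] -/
theorem envelope_of_small_datum {ε₀ ν Mα A : ℝ} (hε : 0 < ε₀) (hMα : 0 ≤ Mα) (hA : 0 < A)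
    {α : Fin m → Fin m → Fin m → ℤ × ℤ × ℤ → ℝ} (hα : ∀ i₁ i₂ i₃ μ, |α i₁ i₂ i₃ μ| ≤ Mα)
    (hν0 : 0 < ν) (hν : 32 * (m : ℝ) ^ 2 * Mα * (1 + ε₀) ^ (2 : ℝ) * A ≤ ν)
    {s : ℝ} {X : Fin m → ℤ → ℝ → ℝ}
    (h0 : ∀ i k, |X i k 0| ≤ A / 2 * (1 + ε₀) ^ (-(k : ℝ)))
    (hlow : ∀ i k, k < 0 → ∀ τ ∈ Icc 0 s, X i k τ = 0)
    (hreg : ∃ M : ℝ, ∀ (τ : ℝ) (i : Fin m) (k : ℤ), (1 + (1 + ε₀) ^ ((10 : ℝ) * k)) * |X i k τ| ≤ M)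
    (hcont : ∀ i k, Continuous (X i k))
    (hder : ∀ i k, ∀ τ ∈ Icc 0 s, HasDerivWithinAt (X i k)
        (quadTerm ε₀ α X i k τ - ν * (1 + ε₀) ^ ((2 : ℝ) * k) * X i k τ) (Icc 0 s) τ) :
    ∀ t ∈ Icc 0 s, ∀ i k, |X i k t| ≤ A * (1 + ε₀) ^ (-(k : ℝ)) := by
  -- adapted from `envelope_of_large_viscosity` (Theorems/WakeRatchetMinimalViscousBlowupLargeNuRegular.lean), datum step generalised
  have hl0 : (0 : ℝ) < 1 + ε₀ := by linarith
  have hpow : ∀ a : ℝ, 0 < (1 + ε₀) ^ a := fun a => Real.rpow_pos_of_pos hl0 a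
  obtain ⟨M, hM⟩ := hreg
  obtain ⟨k₀, htail⟩ := exists_tail_envelope (m := m) hε hA hM
  set H : Set ℝ := {t | ∀ τ ∈ Icc 0 t, τ ≤ s → ∀ (i : Fin m) (k : ℤ), 0 ≤ k → k < k₀ →
    |X i k τ| ≤ 2 * A * (1 + ε₀) ^ (-(k : ℝ))} with hH
  have hall : ∀ t, t ≤ s → t ∈ H → ∀ τ ∈ Icc 0 t, ∀ i k, |X i k τ| ≤ 2 * A * (1 + ε₀) ^ (-(k : ℝ)) := by
    intro t hts ht τ hτ i k
    rcases lt_or_ge k 0 with hk | hk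
    · rw [hlow i k hk τ ⟨hτ.1, hτ.2.trans hts⟩, abs_zero]
      exact mul_nonneg (by linarith) (hpow _).le
    · by_cases hk' : k < k₀
      · exact ht τ hτ (hτ.2.trans hts) i k hk hk'
      · refine (htail τ i k (not_lt.1 hk')).trans ?_
        have := (hpow (-(k : ℝ))).le
        nlinarith
  have himp : ∀ t ∈ Icc 0 s, t ∈ H → ∀ τ ∈ Icc 0 t, ∀ i k, |X i k τ| ≤ A * (1 + ε₀) ^ (-(k : ℝ)) := by
    intro t ht hH'
    refine envelope_improve_of_datum hε hMα hA hα hν0 hν h0 (fun i k hk τ hτ => hlow i k hk τ ⟨hτ.1, hτ.2.trans ht.2⟩)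
      (fun i k τ hτ => ?_) (hall t ht.2 hH')
    exact (hder i k τ ⟨hτ.1, hτ.2.trans ht.2⟩).mono (Icc_subset_Icc_right ht.2)
  have h0H : (0 : ℝ) ∈ H := by
    intro τ hτ _ i k _ _
    have hτ0 : τ = 0 := le_antisymm hτ.2 hτ.1
    subst hτ0
    refine (h0 i k).trans ?_
    have := (hpow (-(k : ℝ))).le
    nlinarith
  have hclosed : IsClosed (H ∩ Icc 0 s) := by
    have heq : H ∩ Icc 0 s = Icc 0 s ∩ ⋂ τ ∈ Icc (0 : ℝ) s, ⋂ (i : Fin m), ⋂ (k : ℤ),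
        {t : ℝ | 0 ≤ k → k < k₀ → |X i k (min τ t)| ≤ 2 * A * (1 + ε₀) ^ (-(k : ℝ))} := by
      ext t
      simp only [hH, mem_inter_iff, mem_iInter, mem_setOf_eq]
      constructor
      · rintro ⟨ht, hts⟩
        exact ⟨hts, fun τ hτ i k hk hk' => ht (min τ t) ⟨le_min hτ.1 hts.1, min_le_right _ _⟩
          ((min_le_right _ _).trans hts.2) i k hk hk'⟩
      · rintro ⟨hts, h⟩
        refine ⟨fun τ hτ _ i k hk hk' => ?_, hts⟩
        have := h τ ⟨hτ.1, hτ.2.trans hts.2⟩ i k hk hk'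
        rwa [min_eq_left hτ.2] at this
    rw [heq]
    refine isClosed_Icc.inter (isClosed_biInter fun τ _ => isClosed_iInter fun i => isClosed_iInter fun k => ?_)
    by_cases hk : 0 ≤ k ∧ k < k₀
    · have : {t : ℝ | 0 ≤ k → k < k₀ → |X i k (min τ t)| ≤ 2 * A * (1 + ε₀) ^ (-(k : ℝ))} =
          {t : ℝ | |X i k (min τ t)| ≤ 2 * A * (1 + ε₀) ^ (-(k : ℝ))} := by
        ext t
        simp only [mem_setOf_eq]
        exact ⟨fun h => h hk.1 hk.2, fun h _ _ => h⟩
      rw [this]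
      exact isClosed_le (continuous_abs.comp ((hcont i k).comp (continuous_const.min continuous_id)))
        continuous_const
    · have : {t : ℝ | 0 ≤ k → k < k₀ → |X i k (min τ t)| ≤ 2 * A * (1 + ε₀) ^ (-(k : ℝ))} = univ := by
        ext t
        simp only [mem_setOf_eq, mem_univ, iff_true]
        exact fun h1 h2 => absurd ⟨h1, h2⟩ hk
      rw [this]
      exact isClosed_univ
  have hstep : ∀ x ∈ H ∩ Ico (0 : ℝ) s, H ∈ 𝓝[>] x := by
    rintro x ⟨hxH, hx⟩
    have himpx := himp x ⟨hx.1, hx.2.le⟩ hxH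
    have hev : ∀ᶠ y in 𝓝 x, ∀ (i : Fin m), ∀ k ∈ Finset.Ico (0 : ℤ) k₀,
        |X i k y| < 2 * A * (1 + ε₀) ^ (-(k : ℝ)) := by
      refine eventually_all.2 fun i => (eventually_all_finset _).2 fun k _ => ?_
      have hlt : |X i k x| < 2 * A * (1 + ε₀) ^ (-(k : ℝ)) := by
        refine lt_of_le_of_lt (himpx x ⟨hx.1, le_rfl⟩ i k) ?_
        have := hpow (-(k : ℝ))
        nlinarith
      exact ((continuous_abs.comp (hcont i k)).continuousAt).eventually_lt continuousAt_const hlt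
    obtain ⟨δ, hδ, hball⟩ := Metric.eventually_nhds_iff.1 hev
    have hsub : Ioo x (x + δ) ⊆ H := by
      intro y hy τ hτ _ i k hk hk'
      rcases le_or_gt τ x with hτx | hτx
      · exact hxH τ ⟨hτ.1, hτx⟩ (hτx.trans hx.2.le) i k hk hk'
      · have hd : dist τ x < δ := by
          rw [Real.dist_eq, abs_of_pos (by linarith)]
          linarith [hτ.2, hy.2]
        exact (hball hd i k (Finset.mem_Ico.2 ⟨hk, hk'⟩)).le
    exact mem_of_superset (Ioo_mem_nhdsGT (by linarith : x < x + δ)) hsub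
  have hIcc : Icc 0 s ⊆ H := hclosed.Icc_subset_of_forall_mem_nhdsWithin h0H hstep
  intro t ht i k
  exact himp t ht (hIcc ht) t ⟨ht.1, le_rfl⟩ i k

/-! ### §3 (E3): restart from an intermediate time -/

/-- **(E3) RESTART ENVELOPE from an intermediate time.**  Structure constants bounded by `M_α`, `λ = 1+ε₀ > 1`, `A > 0`, `ν ≥ 32 m² M_α λ² A`.
A regular solution of the `ν`-viscous lattice on a window `[0,s]` (continuous components, no shells below `0`, (4.5)-weighted bound finite) with
`|X_{i,k}(t₁)| ≤ (A/2)λ^{−k}` at a time `t₁ ∈ [0,s]` obeys `|X_{i,k}(t)| ≤ Aλ^{−k}` on `[t₁,s]` (time shift of `envelope_of_small_datum`).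
[cite: BarbatoMorandinRomito2011, §3.1 Prop. 3.3; Tao2016AveragedNS, §4 Lemma 4.1 (4.5)] -/
theorem envelope_from_time {ε₀ ν Mα A : ℝ} (hε : 0 < ε₀) (hMα : 0 ≤ Mα) (hA : 0 < A)
    {α : Fin m → Fin m → Fin m → ℤ × ℤ × ℤ → ℝ} (hα : ∀ i₁ i₂ i₃ μ, |α i₁ i₂ i₃ μ| ≤ Mα)
    (hν0 : 0 < ν) (hν : 32 * (m : ℝ) ^ 2 * Mα * (1 + ε₀) ^ (2 : ℝ) * A ≤ ν)
    {s t₁ : ℝ} (ht₁ : 0 ≤ t₁) {X : Fin m → ℤ → ℝ → ℝ}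
    (h1 : ∀ i k, |X i k t₁| ≤ A / 2 * (1 + ε₀) ^ (-(k : ℝ)))
    (hlow : ∀ i k, k < 0 → ∀ τ, X i k τ = 0)
    (hreg : ∃ M : ℝ, ∀ (τ : ℝ) (i : Fin m) (k : ℤ), (1 + (1 + ε₀) ^ ((10 : ℝ) * k)) * |X i k τ| ≤ M)
    (hcont : ∀ i k, Continuous (X i k))
    (hder : ∀ i k, ∀ τ ∈ Icc 0 s, HasDerivWithinAt (X i k)
        (quadTerm ε₀ α X i k τ - ν * (1 + ε₀) ^ ((2 : ℝ) * k) * X i k τ) (Icc 0 s) τ) :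
    ∀ t ∈ Icc t₁ s, ∀ i k, |X i k t| ≤ A * (1 + ε₀) ^ (-(k : ℝ)) := by
  intro t ht i k
  -- the shifted solution
  set Y : Fin m → ℤ → ℝ → ℝ := fun j n u => X j n (t₁ + u) with hY
  have hq : ∀ j n u, quadTerm ε₀ α Y j n u = quadTerm ε₀ α X j n (t₁ + u) := fun j n u => rfl
  obtain ⟨M, hM⟩ := hreg
  have hderY : ∀ j n, ∀ u ∈ Icc 0 (s - t₁), HasDerivWithinAt (Y j n)
      (quadTerm ε₀ α Y j n u - ν * (1 + ε₀) ^ ((2 : ℝ) * n) * Y j n u) (Icc 0 (s - t₁)) u := by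
    intro j n u hu
    have hx := hder j n (t₁ + u) ⟨by linarith [hu.1], by linarith [hu.2]⟩
    have hh : HasDerivWithinAt (fun v : ℝ => t₁ + v) 1 (Icc 0 (s - t₁)) u := (hasDerivWithinAt_id u _).const_add t₁
    have hc := hx.comp u hh (fun v hv => ⟨by linarith [hv.1], by linarith [hv.2]⟩)
    rw [mul_one] at hc
    rw [hq]
    exact hc
  have henv := envelope_of_small_datum hε hMα hA hα hν0 hν (s := s - t₁) (X := Y)
    (fun j n => by simpa [hY] using h1 j n)
    (fun j n hn u _ => hlow j n hn (t₁ + u)) ⟨M, fun u j n => hM (t₁ + u) j n⟩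
    (fun j n => (hcont j n).comp (continuous_const.add continuous_id)) hderY (t - t₁)
    ⟨by linarith [ht.1], by linarith [ht.2]⟩ i k
  simpa [hY] using henv

/-! ### §4 Tail energies under an envelope -/

/-- **Envelope ⇒ subcritical tail energies.**  If `|X_{i,k}(t)| ≤ Aλ^{−k}` for all `i, k`, then for all `n ≤ N`,
`Σ_{k=n}^{N} Σ_i ½X_{i,k}(t)² ≤ (m/2)A²(1−λ^{−2})^{−1} λ^{−(1+1)n}`. [folklore] -/
theorem tailEnergy_le_of_envelope {ε₀ A : ℝ} (hε : 0 < ε₀) {X : Fin m → ℤ → ℝ → ℝ} {t : ℝ}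
    (henv : ∀ (i : Fin m) (k : ℤ), |X i k t| ≤ A * (1 + ε₀) ^ (-(k : ℝ))) (n N : ℕ) :
    ∑ k ∈ Finset.Icc n N, ∑ i, (1 / 2 : ℝ) * X i (k : ℤ) t ^ 2 ≤
      (m : ℝ) / 2 * A ^ 2 / (1 - ((1 + ε₀) ^ (2 : ℕ))⁻¹) * (1 + ε₀) ^ (-((1 + 1) * (n : ℝ))) := by
  -- adapted from `largeNuRegular` (Theorems/WakeRatchetMinimalViscousBlowupLargeNuRegular.lean)
  have hl0 : (0 : ℝ) < 1 + ε₀ := by linarith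
  have hl1 : (1 : ℝ) < 1 + ε₀ := by linarith
  set r : ℝ := ((1 + ε₀) ^ (2 : ℕ))⁻¹ with hr
  have hr0 : 0 ≤ r := by rw [hr]; positivity
  have hr1 : r < 1 := by
    rw [hr]
    exact inv_lt_one_of_one_lt₀ (one_lt_pow₀ hl1 two_ne_zero)
  have hrpow : ∀ k : ℕ, (A * (1 + ε₀) ^ (-((k : ℤ) : ℝ))) ^ 2 = A ^ 2 * r ^ k := by
    intro k
    have h1 : (1 + ε₀) ^ (-((k : ℤ) : ℝ)) = ((1 + ε₀) ^ k)⁻¹ := by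
      rw [show (((k : ℤ) : ℝ)) = (k : ℝ) by norm_cast, Real.rpow_neg hl0.le, Real.rpow_natCast]
    rw [h1, hr, mul_pow, inv_pow, inv_pow, ← pow_mul, ← pow_mul, mul_comm 2 k]
  have hrn : r ^ n = (1 + ε₀) ^ (-((1 + 1) * (n : ℝ))) := by
    rw [hr, inv_pow, ← pow_mul, Real.rpow_neg hl0.le, show (1 + 1) * (n : ℝ) = ((2 * n : ℕ) : ℝ) by push_cast; ring,
      Real.rpow_natCast]
  have hterm : ∀ k ∈ Finset.Icc n N, ∑ i, (1 / 2 : ℝ) * X i (k : ℤ) t ^ 2 ≤ (m : ℝ) / 2 * A ^ 2 * r ^ k := by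
    intro k _
    have hk : ∀ i, (1 / 2 : ℝ) * X i (k : ℤ) t ^ 2 ≤ (1 / 2) * (A ^ 2 * r ^ k) := by
      intro i
      refine mul_le_mul_of_nonneg_left ?_ (by norm_num)
      rw [← hrpow k, ← sq_abs]
      exact pow_le_pow_left₀ (abs_nonneg _) (henv i k) 2
    calc ∑ i, (1 / 2 : ℝ) * X i (k : ℤ) t ^ 2 ≤ ∑ _i : Fin m, (1 / 2) * (A ^ 2 * r ^ k) := Finset.sum_le_sum fun i _ => hk i
      _ = (m : ℝ) / 2 * A ^ 2 * r ^ k := by simp; ring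
  have hgeom : ∑ k ∈ Finset.Icc n N, r ^ k ≤ r ^ n / (1 - r) := by
    calc ∑ k ∈ Finset.Icc n N, r ^ k ≤ ∑ k ∈ Finset.Ico n (N + 1), r ^ k := by
          refine Finset.sum_le_sum_of_subset_of_nonneg (fun k hk => ?_) fun k _ _ => pow_nonneg hr0 k
          simp only [Finset.mem_Icc] at hk
          simp only [Finset.mem_Ico]
          omega
      _ ≤ r ^ n / (1 - r) := geom_sum_Ico_le_of_lt_one hr0 hr1
  calc ∑ k ∈ Finset.Icc n N, ∑ i, (1 / 2 : ℝ) * X i (k : ℤ) t ^ 2 ≤ ∑ k ∈ Finset.Icc n N, (m : ℝ) / 2 * A ^ 2 * r ^ k :=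
        Finset.sum_le_sum hterm
    _ = (m : ℝ) / 2 * A ^ 2 * ∑ k ∈ Finset.Icc n N, r ^ k := by rw [Finset.mul_sum]
    _ ≤ (m : ℝ) / 2 * A ^ 2 * (r ^ n / (1 - r)) := mul_le_mul_of_nonneg_left hgeom (by positivity)
    _ = (m : ℝ) / 2 * A ^ 2 / (1 - r) * (1 + ε₀) ^ (-((1 + 1) * (n : ℝ))) := by rw [← hrn]; ring

end Summit.NavierStokesRegularity.NavierStokesRegularity.Theorems.MinimalViscousBlowup.ThresholdRay

end
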